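import Mathlib.Data.Finset.Powerset
import Mathlib.Data.Nat.Factorial.Basic
import Mathlib.Algebra.BigOperators.Ring.Finset
import Mathlib.Algebra.Order.BigOperators.Group.Finset
import Mathlib.Algebra.Group.Action.Defs
import Mathlib.Tactic.Ring
import Mathlib.Tactic.Linarith
import Mathlib.Tactic.Positivity

/-!
# The sparse end of Sahi's hierarchy, I: set partitions of a finset and the signed partition sums `Z_Q`, `N_Q`

Support file of the master-family programme (crux `NoHeavyLowerTail`, stmt-CriticalPhenomena-4575; cell `prim-masterthm`, seat P4,
unit `prim-masterthm-p4-g4`).  Pure finite combinatorics; no measure.  Seat document PROOF-SPARSE-END.md, Theorem 3.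

CONTEXT.  For increasing events `U_1,…,U_k` of a finite cube under the product measure with intensities `p·w_e`, `p → 0`, the
representative form of Sahi's `E_k` (`SahiMasterFamilyRepresentativeForm`) gives `E_k = L·p^m + O(p^{m+1})`, `m` = the minimum size of a
configuration in `⋂ U_i`, and `L` is a positive combination of quantities `Λ(c)`, one for each minimum configuration `c`; each `Λ(c)` is a
signed sum over SET PARTITIONS and equals (by the principal-block / core structure, seat document §2) a number
    `N_Q(b) = Σ_{τ partition of S, all blocks in Q} (−1)^{|τ|+1} ∏_{T ∈ τ} (b_T − 1)!`,   `b_T = Σ_{t∈T} b_t`,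
for a UNION-CLOSED family `Q` of nonempty subsets of a finite set `S` with `S ∈ Q` and weights `b ≥ 1`.  The abstract inequality
`N_Q(b) ≥ 0` is proved in the companions `SahiMasterFamilySparseEndAll` (all subsets) and `SahiMasterFamilySparseEndUnionClosed`.
THIS FILE: set partitions of a finset as families of blocks (`parts`, `mem_parts`), removal of a block (`sum_parts_with_block`), the
block of a point (`blockOf`, `sum_parts_fiber`), the sums `Z_Q`, `N_Q = −Z_Q` (`N_eq_neg_Z`), and the recursion at the block of a
distinguished point (`Z_rec`).
HONEST FRAMING: elementary; [this work].  Nothing here bears on `C_n` [Sahi2008, Conj. 5; Kahn2022, Conj. 5] beyond the seat document.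
-/

namespace Summit.CriticalPhenomena.PercolationContinuityZ3.Theorems

namespace SahiSparseEnd

open Finset

variable {α : Type*} [DecidableEq α]

/-! ### Set partitions of a finset as families of blocks -/

/-- The set partitions of `X`: families of nonempty blocks inside `X`, pairwise disjoint, covering `X`. [this work] -/
def parts (X : Finset α) : Finset (Finset (Finset α)) :=
  X.powerset.powerset.filter fun P =>
    (∀ T ∈ P, T.Nonempty) ∧ (∀ T ∈ P, ∀ T' ∈ P, T ≠ T' → Disjoint T T') ∧ ∀ x ∈ X, ∃ T ∈ P, x ∈ T

/-- Membership in `parts`. [this work] -/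
theorem mem_parts {X : Finset α} {P : Finset (Finset α)} : P ∈ parts X ↔
    (∀ T ∈ P, T.Nonempty ∧ T ⊆ X) ∧ (∀ T ∈ P, ∀ T' ∈ P, T ≠ T' → Disjoint T T') ∧ ∀ x ∈ X, ∃ T ∈ P, x ∈ T := by
  rw [parts, mem_filter, mem_powerset]
  constructor
  · rintro ⟨hsub, hne, hdis, hcov⟩
    exact ⟨fun T hT => ⟨hne T hT, mem_powerset.1 (hsub hT)⟩, hdis, hcov⟩
  · rintro ⟨h1, hdis, hcov⟩
    exact ⟨fun T hT => mem_powerset.2 (h1 T hT).2, fun T hT => (h1 T hT).1, hdis, hcov⟩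

/-- The only partition of `∅` is the empty family. [this work] -/
theorem parts_empty : parts (∅ : Finset α) = {∅} := by
  ext P
  rw [mem_parts, mem_singleton]
  constructor
  · intro h
    refine eq_empty_of_forall_notMem fun T hT => ?_
    obtain ⟨⟨x, hx⟩, hTX⟩ := h.1 T hT
    exact absurd (hTX hx) (by simp)
  · rintro rfl
    exact ⟨fun T hT => absurd hT (by simp), fun T hT => absurd hT (by simp), fun x hx => absurd hx (by simp)⟩

/-- In a partition, the block containing a given point is unique. [this work] -/
theorem block_unique {X : Finset α} {P : Finset (Finset α)} (hP : P ∈ parts X) {T T' : Finset α} (hT : T ∈ P)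
    (hT' : T' ∈ P) {x : α} (hx : x ∈ T) (hx' : x ∈ T') : T = T' := by
  by_contra h
  exact disjoint_left.1 ((mem_parts.1 hP).2.1 T hT T' hT' h) hx hx'

/-- Removing a block `A` of a partition of `X` gives a partition of `X \ A`. [this work] -/
theorem erase_mem_parts {X : Finset α} {P : Finset (Finset α)} (hP' : P ∈ parts X) {A : Finset α} (hA : A ∈ P) :
    P.erase A ∈ parts (X \ A) := by
  have hP := mem_parts.1 hP'
  rw [mem_parts]
  refine ⟨fun T hT => ?_, fun T hT T' hT' hne => hP.2.1 T (mem_of_mem_erase hT) T' (mem_of_mem_erase hT') hne, fun x hx => ?_⟩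
  · obtain ⟨hne, hTP⟩ := mem_erase.1 hT
    refine ⟨(hP.1 T hTP).1, fun y hy => mem_sdiff.2 ⟨(hP.1 T hTP).2 hy, fun hyA => ?_⟩⟩
    exact disjoint_left.1 (hP.2.1 T hTP A hA hne) hy hyA
  · obtain ⟨hxX, hxA⟩ := mem_sdiff.1 hx
    obtain ⟨T, hT, hxT⟩ := hP.2.2 x hxX
    exact ⟨T, mem_erase.2 ⟨fun h => hxA (h ▸ hxT), hT⟩, hxT⟩

/-- Adding a disjoint nonempty block. [this work] -/
theorem insert_mem_parts {X A : Finset α} {P : Finset (Finset α)} (hP' : P ∈ parts (X \ A)) (hAX : A ⊆ X)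
    (hA : A.Nonempty) : insert A P ∈ parts X := by
  have hP := mem_parts.1 hP'
  rw [mem_parts]
  refine ⟨fun T hT => ?_, fun T hT T' hT' hne => ?_, fun x hx => ?_⟩
  · rcases mem_insert.1 hT with rfl | hT
    · exact ⟨hA, hAX⟩
    · exact ⟨(hP.1 T hT).1, (hP.1 T hT).2.trans sdiff_subset⟩
  · rcases mem_insert.1 hT with hTA | hTP
    · rcases mem_insert.1 hT' with hT'A | hT'P
      · exact absurd (hTA.trans hT'A.symm) hne
      · rw [hTA]
        exact disjoint_left.2 fun y hy hy' => (mem_sdiff.1 ((hP.1 T' hT'P).2 hy')).2 hy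
    · rcases mem_insert.1 hT' with hT'A | hT'P
      · rw [hT'A]
        exact disjoint_left.2 fun y hy hy' => (mem_sdiff.1 ((hP.1 T hTP).2 hy)).2 hy'
      · exact hP.2.1 T hTP T' hT'P hne
  · by_cases hxA : x ∈ A
    · exact ⟨A, mem_insert_self _ _, hxA⟩
    · obtain ⟨T, hT, hxT⟩ := hP.2.2 x (mem_sdiff.2 ⟨hx, hxA⟩)
      exact ⟨T, mem_insert_of_mem hT, hxT⟩

/-- A block of a partition of `X \ A` is not `A` (for `A` nonempty). [this work] -/
theorem not_mem_of_mem_parts_sdiff {X A : Finset α} {P : Finset (Finset α)} (hP : P ∈ parts (X \ A)) (hA : A.Nonempty) :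
    A ∉ P := by
  intro h
  obtain ⟨x, hx⟩ := hA
  exact (mem_sdiff.1 (((mem_parts.1 hP).1 A h).2 hx)).2 hx

/-- **Removing a block**: summing over the partitions of `X` having `A` as a block is summing over the partitions of `X \ A`.
[this work] -/
theorem sum_parts_with_block {β : Type*} [AddCommMonoid β] {X A : Finset α} (hAX : A ⊆ X) (hA : A.Nonempty)
    (f : Finset (Finset α) → β) :
    ∑ P ∈ (parts X).filter (fun P => A ∈ P), f P = ∑ P ∈ parts (X \ A), f (insert A P) := by
  refine sum_nbij' (fun P => P.erase A) (fun P => insert A P) ?_ ?_ ?_ ?_ ?_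
  · intro P hP
    rw [mem_filter] at hP
    exact erase_mem_parts hP.1 hP.2
  · intro P hP
    rw [mem_filter]
    exact ⟨insert_mem_parts hP hAX hA, mem_insert_self _ _⟩
  · intro P hP
    rw [mem_filter] at hP
    exact insert_erase hP.2
  · intro P hP
    exact erase_insert (not_mem_of_mem_parts_sdiff hP hA)
  · intro P hP
    rw [mem_filter] at hP
    rw [insert_erase hP.2]

/-- The block of `P` containing `s`. [this work] -/
def blockOf (P : Finset (Finset α)) (s : α) : Finset α := (P.filter fun T => s ∈ T).sup id

/-- In a partition of `X ∋ s`, `blockOf P s` is the block containing `s`. [this work] -/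
theorem blockOf_spec {X : Finset α} {P : Finset (Finset α)} (hP : P ∈ parts X) {s : α} (hs : s ∈ X) :
    blockOf P s ∈ P ∧ s ∈ blockOf P s := by
  obtain ⟨T, hT, hsT⟩ := (mem_parts.1 hP).2.2 s hs
  have hfilt : P.filter (fun T' => s ∈ T') = {T} := by
    ext T'
    rw [mem_filter, mem_singleton]
    exact ⟨fun h => block_unique hP h.1 hT h.2 hsT, fun h => h ▸ ⟨hT, hsT⟩⟩
  have : blockOf P s = T := by rw [blockOf, hfilt, sup_singleton, id]
  rw [this]
  exact ⟨hT, hsT⟩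

/-- A block containing `s` is `blockOf P s`. [this work] -/
theorem eq_blockOf {X : Finset α} {P : Finset (Finset α)} (hP : P ∈ parts X) {s : α} (hs : s ∈ X) {T : Finset α}
    (hT : T ∈ P) (hsT : s ∈ T) : T = blockOf P s :=
  block_unique hP hT (blockOf_spec hP hs).1 hsT (blockOf_spec hP hs).2

/-- **Fibring by the block of a point**: a sum over the partitions of `X ∋ s` is the sum over the blocks `T ∋ s` of the sums over
partitions having `T` as a block. [this work] -/
theorem sum_parts_fiber {β : Type*} [AddCommMonoid β] {X : Finset α} {s : α} (hs : s ∈ X) (f : Finset (Finset α) → β) :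
    ∑ P ∈ parts X, f P = ∑ T ∈ X.powerset.filter (fun T => s ∈ T), ∑ P ∈ (parts X).filter (fun P => T ∈ P), f P := by
  rw [← sum_fiberwise_of_maps_to (s := parts X) (t := X.powerset.filter (fun T => s ∈ T)) (g := fun P => blockOf P s)]
  · refine sum_congr rfl fun T hT => sum_congr ?_ fun _ _ => rfl
    ext P
    simp only [mem_filter]
    constructor
    · rintro ⟨hP, hb⟩
      exact ⟨hP, hb ▸ (blockOf_spec hP hs).1⟩
    · rintro ⟨hP, hTP⟩
      rw [mem_filter, mem_powerset] at hT
      exact ⟨hP, (eq_blockOf hP hs hTP hT.2).symm⟩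
  · intro P hP
    rw [mem_filter, mem_powerset]
    exact ⟨((mem_parts.1 hP).1 _ (blockOf_spec hP hs).1).2, (blockOf_spec hP hs).2⟩

/-! ### The signed partition sum of a family `Q` with weights `b` -/

/-- The block weight `(b_T − 1)!`, `b_T = Σ_{t∈T} b_t`. [this work] -/
def bw (b : α → ℕ) (T : Finset α) : ℤ := (((∑ x ∈ T, b x) - 1).factorial : ℤ)

/-- `Z_Q(b; X) = Σ_{partitions of X with all blocks in Q} ∏_T (−(b_T − 1)!)` (so that `N_Q = −Z_Q`). [this work] -/
def Z (Q : Finset (Finset α)) (b : α → ℕ) (X : Finset α) : ℤ :=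
  ∑ P ∈ (parts X).filter (fun P => P ⊆ Q), ∏ T ∈ P, (-bw b T)

/-- **`N_Q(b; X) = Σ_{τ partition of X, blocks in Q} (−1)^{|τ|+1} ∏_{T∈τ} (b_T − 1)!`.** [this work] -/
def N (Q : Finset (Finset α)) (b : α → ℕ) (X : Finset α) : ℤ :=
  ∑ P ∈ (parts X).filter (fun P => P ⊆ Q), (-1) ^ (P.card + 1) * ∏ T ∈ P, bw b T

/-- `N = −Z`. [this work] -/
theorem N_eq_neg_Z (Q : Finset (Finset α)) (b : α → ℕ) (X : Finset α) : N Q b X = -Z Q b X := by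
  rw [N, Z, ← sum_neg_distrib]
  refine sum_congr rfl fun P _ => ?_
  rw [pow_succ, prod_neg (s := P) (f := bw b)]
  ring

/-- `Z` on the empty set is `1`. [this work] -/
theorem Z_empty (Q : Finset (Finset α)) (b : α → ℕ) : Z Q b ∅ = 1 := by
  rw [Z, parts_empty]
  rw [filter_singleton, if_pos (empty_subset _), sum_singleton, prod_empty]

/-- `Z` depends on `b` only through its values on `X`. [this work] -/
theorem Z_congr {Q : Finset (Finset α)} {b b' : α → ℕ} {X : Finset α} (h : ∀ x ∈ X, b x = b' x) : Z Q b X = Z Q b' X := by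
  refine sum_congr rfl fun P hP => prod_congr rfl fun T hT => ?_
  rw [mem_filter] at hP
  have hTX := ((mem_parts.1 hP.1).1 T hT).2
  rw [bw, bw, sum_congr rfl fun x hx => h x (hTX hx)]

/-- **The recursion at the block of a distinguished point**: for `s ∈ X`,
`Z_Q(X) = Σ_{T ∋ s, T ⊆ X, T ∈ Q} (−(b_T−1)!)·Z_Q(X \ T)`. [this work] -/
theorem Z_rec (Q : Finset (Finset α)) (b : α → ℕ) {X : Finset α} {s : α} (hs : s ∈ X) :
    Z Q b X = ∑ T ∈ X.powerset.filter (fun T => s ∈ T ∧ T ∈ Q), (-bw b T) * Z Q b (X \ T) := by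
  have hsplit : X.powerset.filter (fun T => s ∈ T ∧ T ∈ Q) = (X.powerset.filter (fun T => s ∈ T)).filter (fun T => T ∈ Q) :=
    (filter_filter _ _ _).symm
  rw [hsplit, sum_filter, Z, sum_filter, sum_parts_fiber hs]
  refine sum_congr rfl fun T hT => ?_
  rw [mem_filter, mem_powerset] at hT
  have hTne : T.Nonempty := ⟨s, hT.2⟩
  rw [← sum_filter, sum_filter, sum_parts_with_block hT.1 hTne]
  by_cases hTQ : T ∈ Q
  · rw [if_pos hTQ, Z, mul_sum, ← sum_filter]
    refine sum_congr ?_ fun P hP => ?_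
    · ext P
      simp only [mem_filter]
      constructor
      · rintro ⟨hP, hsub⟩
        exact ⟨hP, (subset_insert _ _).trans hsub⟩
      · rintro ⟨hP, hsub⟩
        exact ⟨hP, insert_subset hTQ hsub⟩
    · rw [mem_filter] at hP
      rw [prod_insert (not_mem_of_mem_parts_sdiff hP.1 hTne)]
  · rw [if_neg hTQ]
    refine sum_eq_zero fun P _ => ?_
    rw [if_neg]
    exact fun h => hTQ (h (mem_insert_self _ _))

end SahiSparseEnd

end Summit.CriticalPhenomena.PercolationContinuityZ3.Theorems
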